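import Literature.Probability.RandomPlanarGeometry.RadialBesselDynkin
import HarnessLib

/-!
# Continuity in the starting point of the exit functionals of the radial Bessel process

Topic `Probability/RandomPlanarGeometry`; theorems only, sequel of `RadialBesselDynkin`. For the
SLE_κ radial Bessel process (LSW (2002), (2.9)–(2.11)), `κ > 4`, and a bounded continuous `φ`, the
exit functionals `a_φ(y) = E^y[φ(T); Y_T = 2π]` (`topExpect`) and `b_φ(y) = E^y[φ(T); Y_T = 0]`
(`botExpect`) are **continuous on `(0, 2π)`** (`continuousOn_topExpect`, `continuousOn_botExpect`).

The proof is probabilistic and uses no regularity theory: for `θ < β` close to `θ` let `τ` be the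
exit time of `Y^θ` from `(α, β)` (`α < θ` fixed). By the mean-value property
(`integral_topExpect_stoppedValue_eq`), `P[Y_τ = α] a(α) + P[Y_τ = β] a(β) = E[φ(T - τ); Y_T = 2π]`;
optional stopping of the scale-function martingale gives
`P[Y_τ = α] = (s(β) - s(θ))/(s(β) - s(α)) → 0`, and of `(Y - θ)²` gives `E[τ ∧ 1] → 0`, as
`β ↓ θ`; since `φ` is uniformly continuous on compacts, `E|φ(T - τ) - φ(T)| → 0`, whence
`a(β) → a(θ)`. Left limits are symmetric. Tools proved here, of independent use:

* `integral_apply_stoppedProcess_eq` — **Dynkin's formula at a stopping time `τ ≤ σₙ`** for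
  `F ∈ C²`: `E[F(Y_{t∧τ})] = F(θ) + E[∫₀^{t∧τ} (Λ₀ F)(Y_s) ds]`, `Λ₀ F = (κ/2) F'' + cot(·/2) F'`
  (optional stopping of the generator martingale of `RadialBesselSLE` at `τ`, via the stopped
  a.e.-martingale theorem of `Process.StoppedMartingale`);
* the exit time `τ` of the level-`n` flow from a sub-interval `(α, β)` (`Process.exitTime`): it is a
  stopping time before `σₙ`, the exit position is `α` or `β`, the scale-function identity
  `E[s(Y_τ)] = s(θ)` (`integral_sleScale_stoppedValue_subExit`) and the bound
  `E[τ ∧ t] ≤ (2/κ) E[(Y_{t∧τ} - θ)²]` on short intervals (`integral_min_subExit_le`).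

## References

* G. F. Lawler, O. Schramm, W. Werner, *One-arm exponent for critical 2D percolation*, Electron.
  J. Probab. 7 (2002), no. 2, §2, proof of Lemma 2.2. [LawlerSchrammWernerEJP2002]
* G. F. Lawler, *Conformally Invariant Processes in the Plane*, AMS (2005), §1.11 (Prop. 1.30,
  Lemma 1.25: optional stopping for one-dimensional diffusions on an interval). [Lawler2005]
-/

noncomputable section

open MeasureTheory ProbabilityTheory Filter Topology Set
open scoped NNReal ENNReal

namespace Literature.Probability.RandomPlanarGeometry

namespace RadialLoewner

open Literature.Probability.Process Literature.Analysis.FunctionSpaces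

variable {κ : ℝ≥0} {n : ℕ} {θ : ℝ}

/-! ### Dynkin's formula at a stopping time before `σₙ` -/

/-- **Dynkin's formula at a stopping time `τ ≤ σₙ`, with the integrability of the generator term.**
For `F ∈ C²(ℝ)`, `θ` in the level-`n` interval and a stopping time `τ ≤ σₙ(θ)` of the raw Brownian
filtration, `ω ↦ ∫₀^{t∧τ} (Λ₀F)(Y_s) ds` is integrable and
`E[F(Y_{t∧τ})] = F(θ) + E[∫₀^{t∧τ} (Λ₀F)(Y_s) ds]` with `Λ₀F = (κ/2)F'' + cot(·/2)F'`
(`expGenerator κ 0 F`). Proof: the generator martingale `F(Y_{t∧σₙ}) - ∫₀^{t∧σₙ} Λ₀F(Y_s) ds`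
(`martingale_expGenerator_sleArgLevel`, `μ = 0`) has continuous paths, so its process stopped at
`τ` is an a.e. martingale (`Martingale.isAEMartingale_stoppedProcess`) with constant expectation.
Lawler (2005), Prop. 1.30 / Revuz–Yor (1999), Ch. VII, Prop. (1.2). [cite: Lawler2005, §1.11 Prop. 1.30] -/
theorem integral_apply_stoppedProcess_eq_aux (hθn : θ ∈ Ioo (2 * level n) (2 * Real.pi - 2 * level n))
    {F : ℝ → ℝ} (hF : ContDiff ℝ 2 F) {τ : (ℝ≥0 → ℝ) → WithTop ℝ≥0}
    (hτ : IsStoppingTime brownianFiltration τ) (hτσ : ∀ ω, τ ω ≤ sleExitLevel κ n θ ω) (t : ℝ≥0) :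
    Integrable (fun ω ↦ ∫ s in (0 : ℝ)..(((min (t : WithTop ℝ≥0) (τ ω)).untopA : ℝ≥0) : ℝ),
        expGenerator κ 0 F (sleArgLevel κ n θ s.toNNReal ω)) preWienerMeasure ∧
    ∫ ω, F (stoppedProcess (sleArgLevel κ n θ) τ t ω) ∂preWienerMeasure =
      F θ + ∫ ω, (∫ s in (0 : ℝ)..(((min (t : WithTop ℝ≥0) (τ ω)).untopA : ℝ≥0) : ℝ),
        expGenerator κ 0 F (sleArgLevel κ n θ s.toNNReal ω)) ∂preWienerMeasure := by
  haveI := isProbabilityMeasure_preWienerMeasure'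
  have hM0 := martingale_expGenerator_sleArgLevel (κ := κ) hθn hF 0
  -- the martingale with the trivial clock removed
  set M : ℝ≥0 → (ℝ≥0 → ℝ) → ℝ := fun t ω ↦ F (stoppedProcess (sleArgLevel κ n θ) (sleExitLevel κ n θ) t ω) -
    ∫ s in (0 : ℝ)..t, genDrift κ n θ 0 F s.toNNReal ω with hMdef
  have hclock : ∀ t ω, expClock κ n θ 0 t ω = 1 := fun t ω ↦ by
    rw [expClock_apply, zero_mul, Real.exp_zero]
  have hM : Martingale M brownianFiltration preWienerMeasure := by
    have : (fun t ω ↦ expClock κ n θ 0 t ω * F (stoppedProcess (sleArgLevel κ n θ) (sleExitLevel κ n θ) t ω) -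
        ∫ s in (0 : ℝ)..t, genDrift κ n θ 0 F s.toNNReal ω) = M := by
      funext t ω; rw [hMdef, hclock, one_mul]
    rw [← this]; exact hM0
  have hMc : ∀ ω, Continuous fun t ↦ M t ω := by
    intro ω
    refine ((hF.continuous.comp (continuous_stoppedProcess_sleArgLevel κ n θ (sleExitLevel κ n θ) ω)).sub ?_)
    exact (intervalIntegral.continuous_primitive
      (fun a b ↦ intervalIntegrable_genDrift hθn hF 0 ω a b) 0).comp NNReal.continuous_coe
  have hAE := hM.isAEMartingale_stoppedProcess (Eventually.of_forall hMc) hτ.isOptionalTime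
  have hkey := hAE.integral_mul_eq (zero_le : (0 : ℝ≥0) ≤ t) (H := fun _ ↦ (1 : ℝ)) aestronglyMeasurable_const
    (C := 1) (Eventually.of_forall fun _ ↦ by simp)
  simp only [one_mul] at hkey
  -- the stopped process at time `0`
  have h0 : ∀ ω, stoppedProcess M τ 0 ω = F θ := by
    intro ω
    rw [stoppedProcess_eq_of_le (coe_zero_le_withTop _), hMdef]
    simp only [NNReal.coe_zero, intervalIntegral.integral_same, sub_zero]
    rw [stoppedProcess_eq_of_le (coe_zero_le_withTop _)]
    exact congrArg F (argTrunc_zero _ _ _ θ ω)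
  -- the stopped process at time `t`
  have hrσ : ∀ ω, ((((min (t : WithTop ℝ≥0) (τ ω)).untopA : ℝ≥0) : WithTop ℝ≥0)) ≤ sleExitLevel κ n θ ω :=
    fun ω ↦ (coe_untopA_min_le t (τ ω)).trans (hτσ ω)
  have ht : ∀ ω, stoppedProcess M τ t ω = F (stoppedProcess (sleArgLevel κ n θ) τ t ω) -
      ∫ s in (0 : ℝ)..(((min (t : WithTop ℝ≥0) (τ ω)).untopA : ℝ≥0) : ℝ),
        expGenerator κ 0 F (sleArgLevel κ n θ s.toNNReal ω) := by
    intro ω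
    change M ((min (t : WithTop ℝ≥0) (τ ω)).untopA) ω = _
    rw [hMdef]
    simp only
    congr 1
    · rw [stoppedProcess_eq_of_le (hrσ ω)]; rfl
    · refine intervalIntegral.integral_congr fun s hs ↦ ?_
      rw [uIcc_of_le (NNReal.coe_nonneg _)] at hs
      have hsσ : ((s.toNNReal : ℝ≥0) : WithTop ℝ≥0) ≤ sleExitLevel κ n θ ω :=
        (WithTop.coe_le_coe.2 ((Real.toNNReal_le_iff_le_coe).2 hs.2)).trans (hrσ ω)
      simp only [genDrift_apply, trunc_apply]
      rw [if_pos hsσ, zero_mul, Real.exp_zero, one_mul, stoppedProcess_eq_of_le hsσ]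
  -- integrability of `F(Y_{t∧τ})`
  have hVmeas : Measurable fun ω ↦ stoppedProcess (sleArgLevel κ n θ) τ t ω :=
    (stronglyAdapted_stoppedProcess_sleArgLevel κ n θ hτ t).measurable.mono (brownianFiltration.le t) le_rfl
  have hVmem : ∀ ω, stoppedProcess (sleArgLevel κ n θ) τ t ω ∈ Icc (2 * level n) (2 * Real.pi - 2 * level n) :=
    fun ω ↦ argTrunc_mem_Icc_of_le_truncExit _ (level_pos n) (level_le n) hθn ω (hrσ ω)
  obtain ⟨C, hC⟩ := (isCompact_Icc (a := 2 * level n) (b := 2 * Real.pi - 2 * level n)).exists_bound_of_continuousOn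
    hF.continuous.continuousOn
  have hFi : Integrable (fun ω ↦ F (stoppedProcess (sleArgLevel κ n θ) τ t ω)) preWienerMeasure :=
    integrable_of_abs_le (hF.continuous.measurable.comp hVmeas) fun ω ↦ by
      simpa [Real.norm_eq_abs] using hC _ (hVmem ω)
  have hIi : Integrable (fun ω ↦ ∫ s in (0 : ℝ)..(((min (t : WithTop ℝ≥0) (τ ω)).untopA : ℝ≥0) : ℝ),
      expGenerator κ 0 F (sleArgLevel κ n θ s.toNNReal ω)) preWienerMeasure := by
    have h := hFi.sub (hAE.integrable t)
    refine h.congr (Eventually.of_forall fun ω ↦ ?_)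
    simp only [Pi.sub_apply, ht ω]
    ring
  have hint : ∫ ω, stoppedProcess M τ t ω ∂preWienerMeasure =
      (∫ ω, F (stoppedProcess (sleArgLevel κ n θ) τ t ω) ∂preWienerMeasure) -
        ∫ ω, (∫ s in (0 : ℝ)..(((min (t : WithTop ℝ≥0) (τ ω)).untopA : ℝ≥0) : ℝ),
          expGenerator κ 0 F (sleArgLevel κ n θ s.toNNReal ω)) ∂preWienerMeasure := by
    rw [← integral_sub hFi hIi]
    exact integral_congr_ae (Eventually.of_forall ht)
  rw [hint] at hkey
  simp only [h0, integral_const, smul_eq_mul, probReal_univ, one_mul] at hkey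
  exact ⟨hIi, by linarith⟩

/-- The time integral of `Λ₀F` along the flow up to `t ∧ τ` is integrable (`τ ≤ σₙ` a stopping
time, `F ∈ C²`). [folklore] -/
theorem integrable_intervalIntegral_expGenerator (hθn : θ ∈ Ioo (2 * level n) (2 * Real.pi - 2 * level n))
    {F : ℝ → ℝ} (hF : ContDiff ℝ 2 F) {τ : (ℝ≥0 → ℝ) → WithTop ℝ≥0}
    (hτ : IsStoppingTime brownianFiltration τ) (hτσ : ∀ ω, τ ω ≤ sleExitLevel κ n θ ω) (t : ℝ≥0) :
    Integrable (fun ω ↦ ∫ s in (0 : ℝ)..(((min (t : WithTop ℝ≥0) (τ ω)).untopA : ℝ≥0) : ℝ),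
        expGenerator κ 0 F (sleArgLevel κ n θ s.toNNReal ω)) preWienerMeasure :=
  (integral_apply_stoppedProcess_eq_aux hθn hF hτ hτσ t).1

/-- **Dynkin's formula at a stopping time `τ ≤ σₙ`**: `E[F(Y_{t∧τ})] = F(θ) + E[∫₀^{t∧τ} (Λ₀F)(Y_s) ds]`
(`F ∈ C²`, `θ` in the level-`n` interval). Lawler (2005), Prop. 1.30 / Revuz–Yor (1999), Ch. VII,
Prop. (1.2). [cite: Lawler2005, §1.11 Prop. 1.30] -/
theorem integral_apply_stoppedProcess_eq (hθn : θ ∈ Ioo (2 * level n) (2 * Real.pi - 2 * level n))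
    {F : ℝ → ℝ} (hF : ContDiff ℝ 2 F) {τ : (ℝ≥0 → ℝ) → WithTop ℝ≥0}
    (hτ : IsStoppingTime brownianFiltration τ) (hτσ : ∀ ω, τ ω ≤ sleExitLevel κ n θ ω) (t : ℝ≥0) :
    ∫ ω, F (stoppedProcess (sleArgLevel κ n θ) τ t ω) ∂preWienerMeasure =
      F θ + ∫ ω, (∫ s in (0 : ℝ)..(((min (t : WithTop ℝ≥0) (τ ω)).untopA : ℝ≥0) : ℝ),
        expGenerator κ 0 F (sleArgLevel κ n θ s.toNNReal ω)) ∂preWienerMeasure :=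
  (integral_apply_stoppedProcess_eq_aux hθn hF hτ hτσ t).2

/-! ### Exit from a sub-interval of the level-`n` interval -/

section SubExit

variable (hκ : 4 < κ) {α β : ℝ} (hα : 2 * level n ≤ α) (hβ : β ≤ 2 * Real.pi - 2 * level n)
  (hθ : θ ∈ Ioo α β)

/-- The exit time of the level-`n` flow from `(α, β)` is a stopping time. [folklore] -/
theorem isStoppingTime_subExit (α β : ℝ) :
    IsStoppingTime brownianFiltration (Process.exitTime (sleArgLevel κ n θ) α β) :=
  Process.isStoppingTime_exitTime (adapted_sleArgLevel κ n θ) (continuous_sleArgLevel κ n θ)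

include hα hβ in
/-- The exit time from a sub-interval is before `σₙ`. [folklore] -/
theorem subExit_le_sleExitLevel (ω : ℝ≥0 → ℝ) :
    Process.exitTime (sleArgLevel κ n θ) α β ω ≤ sleExitLevel κ n θ ω := by
  by_cases htop : sleExitLevel κ n θ ω = ⊤
  · rw [htop]; exact le_top
  · obtain ⟨T, hT⟩ := WithTop.ne_top_iff_exists.1 htop
    rw [← hT, Process.exitTime_le_coe_iff (continuous_sleArgLevel κ n θ ω)]
    refine ⟨T, le_rfl, fun hmem ↦ ?_⟩
    have hout := Process.notMem_Ioo_of_exitTime_eq_coe (u := sleArgLevel κ n θ)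
      (a := 2 * level n) (b := 2 * Real.pi - 2 * level n) (continuous_sleArgLevel κ n θ ω) hT.symm
    exact hout ⟨lt_of_le_of_lt hα hmem.1, lt_of_lt_of_le hmem.2 hβ⟩

include hθ in
/-- The level-`n` flow starts inside `(α, β)`. [folklore] -/
theorem sleArgLevel_zero_mem_Ioo (ω : ℝ≥0 → ℝ) : sleArgLevel κ n θ 0 ω ∈ Ioo α β := by
  rw [show sleArgLevel κ n θ 0 ω = θ from argTrunc_zero _ _ _ θ ω]; exact hθ

include hθ in
/-- The flow stopped at the exit time from `(α, β)` stays in `[α, β]`. [folklore] -/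
theorem stoppedProcess_subExit_mem_Icc (t : ℝ≥0) (ω : ℝ≥0 → ℝ) :
    stoppedProcess (sleArgLevel κ n θ) (Process.exitTime (sleArgLevel κ n θ) α β) t ω ∈ Icc α β :=
  Process.stoppedProcess_exitTime_mem_Icc (continuous_sleArgLevel κ n θ ω) (sleArgLevel_zero_mem_Ioo hθ ω) t

include hθ in
/-- At a finite exit time the flow sits at `α` or at `β`. [folklore] -/
theorem stoppedValue_subExit_eq_or {ω : ℝ≥0 → ℝ} {T : ℝ≥0}
    (hT : Process.exitTime (sleArgLevel κ n θ) α β ω = T) :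
    stoppedValue (sleArgLevel κ n θ) (Process.exitTime (sleArgLevel κ n θ) α β) ω = α ∨
      stoppedValue (sleArgLevel κ n θ) (Process.exitTime (sleArgLevel κ n θ) α β) ω = β := by
  have h := Process.apply_eq_or_eq_of_exitTime_eq_coe (continuous_sleArgLevel κ n θ ω)
    (sleArgLevel_zero_mem_Ioo hθ ω) hT
  have hsv : stoppedValue (sleArgLevel κ n θ) (Process.exitTime (sleArgLevel κ n θ) α β) ω =
      sleArgLevel κ n θ T ω := by
    rw [stoppedValue, hT]; rfl
  rw [hsv]; exact h

include hκ hα hβ hθ in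
/-- **The exit position is `α` or `β` almost surely** (`κ > 4`: the exit time is a.s. finite).
[folklore] -/
theorem ae_stoppedValue_subExit_eq_or :
    ∀ᵐ ω ∂preWienerMeasure,
      stoppedValue (sleArgLevel κ n θ) (Process.exitTime (sleArgLevel κ n θ) α β) ω = α ∨
        stoppedValue (sleArgLevel κ n θ) (Process.exitTime (sleArgLevel κ n θ) α β) ω = β := by
  filter_upwards [ae_ne_top_of_le_sleExitLevel hκ (subExit_le_sleExitLevel (θ := θ) hα hβ)] with ω hω
  obtain ⟨T, hT⟩ := WithTop.ne_top_iff_exists.1 hω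
  exact stoppedValue_subExit_eq_or hθ hT.symm

/-- The exit position is measurable. [folklore] -/
theorem measurable_stoppedValue_subExit (α β : ℝ) :
    Measurable (stoppedValue (sleArgLevel κ n θ) (Process.exitTime (sleArgLevel κ n θ) α β)) :=
  (measurable_stoppedValue_sleArgLevel (isStoppingTime_subExit α β)).mono
    (isStoppingTime_subExit (κ := κ) (n := n) (θ := θ) α β).measurableSpace_le le_rfl

include hκ hα hβ hθ in
/-- **The integral of a function of the exit position**: for `g` with `g(α), g(β)` the two possible
values, `E[g(Y_τ)] = g(α) P[Y_τ = α] + g(β) (1 - P[Y_τ = α])`. [folklore] -/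
theorem integral_comp_stoppedValue_subExit (g : ℝ → ℝ) :
    ∫ ω, g (stoppedValue (sleArgLevel κ n θ) (Process.exitTime (sleArgLevel κ n θ) α β) ω) ∂preWienerMeasure =
      g α * preWienerMeasure.real
        {ω | stoppedValue (sleArgLevel κ n θ) (Process.exitTime (sleArgLevel κ n θ) α β) ω = α} +
      g β * (1 - preWienerMeasure.real
        {ω | stoppedValue (sleArgLevel κ n θ) (Process.exitTime (sleArgLevel κ n θ) α β) ω = α}) := by
  haveI := isProbabilityMeasure_preWienerMeasure'
  set Y := stoppedValue (sleArgLevel κ n θ) (Process.exitTime (sleArgLevel κ n θ) α β) with hY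
  set A := {ω : ℝ≥0 → ℝ | Y ω = α} with hA
  have hAm : MeasurableSet A := measurable_stoppedValue_subExit α β (measurableSet_singleton α)
  have hαβ : α < β := hθ.1.trans hθ.2
  have hae : (fun ω ↦ g (Y ω)) =ᵐ[preWienerMeasure]
      fun ω ↦ A.indicator (fun _ ↦ g α) ω + Aᶜ.indicator (fun _ ↦ g β) ω := by
    filter_upwards [ae_stoppedValue_subExit_eq_or hκ hα hβ hθ] with ω hω
    rcases hω with h | h
    · have hωA : ω ∈ A := h
      rw [indicator_of_mem hωA, indicator_of_notMem (show ω ∉ Aᶜ from fun h' ↦ h' hωA), add_zero]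
      exact congrArg g h
    · have hωA : ω ∉ A := fun h' ↦ by
        have : α = β := (show Y ω = α from h').symm.trans h
        exact hαβ.ne this
      rw [indicator_of_notMem hωA, indicator_of_mem (show ω ∈ Aᶜ from hωA), zero_add]
      exact congrArg g h
  rw [integral_congr_ae hae, integral_add ((integrable_const _).indicator hAm)
    ((integrable_const _).indicator hAm.compl), integral_indicator_const _ hAm,
    integral_indicator_const _ hAm.compl, smul_eq_mul, smul_eq_mul, measureReal_compl hAm,
    probReal_univ]
  ring

include hκ hα hβ hθ in
/-- **The scale-function identity at the exit time from `(α, β)`**: `E[s(Y_τ)] = s(θ)`,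
`s = sleScale κ` (Dynkin's formula at `τ` for a `C²` extension of `s`, `Λ₀ s = 0`, and bounded
convergence `t → ∞`). Lawler (2005), Lemma 1.25. [cite: Lawler2005, §1.11 Lemma 1.25] -/
theorem integral_sleScale_stoppedValue_subExit :
    ∫ ω, sleScale κ (stoppedValue (sleArgLevel κ n θ) (Process.exitTime (sleArgLevel κ n θ) α β) ω)
      ∂preWienerMeasure = sleScale κ θ := by
  haveI := isProbabilityMeasure_preWienerMeasure'
  have hθn : θ ∈ Ioo (2 * level n) (2 * Real.pi - 2 * level n) :=
    ⟨lt_of_le_of_lt hα hθ.1, lt_of_lt_of_le hθ.2 hβ⟩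
  have hτ := isStoppingTime_subExit (κ := κ) (n := n) (θ := θ) α β
  have hτσ := subExit_le_sleExitLevel (κ := κ) (n := n) (θ := θ) hα hβ
  obtain ⟨F, hF, hFeq⟩ := exists_contDiff_sleScale hκ n
  have hIcc : Icc α β ⊆ Icc (2 * level n) (2 * Real.pi - 2 * level n) := Icc_subset_Icc hα hβ
  have hFval : ∀ y ∈ Icc α β, F y = sleScale κ y := fun y hy ↦
    (hFeq y (Icc_level_subset_Ioo_level n (hIcc hy))).eq_of_nhds
  have hgen : ∀ y ∈ Icc α β, expGenerator κ 0 F y = 0 := by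
    intro y hy
    rw [expGenerator_congr (hFeq y (Icc_level_subset_Ioo_level n (hIcc hy)))]
    exact expGenerator_sleScale hκ (Icc_level_subset_Ioo n (hIcc hy))
  -- Dynkin at `τ`: the generator term vanishes
  have hdyn : ∀ k : ℕ, ∫ ω, F (stoppedProcess (sleArgLevel κ n θ)
      (Process.exitTime (sleArgLevel κ n θ) α β) k ω) ∂preWienerMeasure = F θ := by
    intro k
    rw [integral_apply_stoppedProcess_eq hθn hF hτ hτσ k]
    have hzero : ∀ ω, (∫ s in (0 : ℝ)..(((min ((k : ℝ≥0) : WithTop ℝ≥0)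
        (Process.exitTime (sleArgLevel κ n θ) α β ω)).untopA : ℝ≥0) : ℝ),
        expGenerator κ 0 F (sleArgLevel κ n θ s.toNNReal ω)) = 0 := by
      intro ω
      refine (intervalIntegral.integral_congr (g := fun _ ↦ (0 : ℝ)) fun s hs ↦ ?_).trans (by simp)
      rw [uIcc_of_le (NNReal.coe_nonneg _)] at hs
      have hsτ : ((s.toNNReal : ℝ≥0) : WithTop ℝ≥0) ≤ Process.exitTime (sleArgLevel κ n θ) α β ω :=
        (WithTop.coe_le_coe.2 ((Real.toNNReal_le_iff_le_coe).2 hs.2)).trans (coe_untopA_min_le _ _)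
      have hmem : sleArgLevel κ n θ s.toNNReal ω ∈ Icc α β := by
        have := stoppedProcess_subExit_mem_Icc (κ := κ) (n := n) hθ s.toNNReal ω
        rwa [stoppedProcess_eq_of_le hsτ] at this
      exact hgen _ hmem
    simp only [hzero, integral_zero, add_zero]
  -- bounded convergence `k → ∞`
  obtain ⟨C, hC⟩ := (isCompact_Icc (a := α) (b := β)).exists_bound_of_continuousOn hF.continuous.continuousOn
  have hlim : ∀ᵐ ω ∂preWienerMeasure, Tendsto (fun k : ℕ ↦ F (stoppedProcess (sleArgLevel κ n θ)
      (Process.exitTime (sleArgLevel κ n θ) α β) k ω))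
      atTop (𝓝 (sleScale κ (stoppedValue (sleArgLevel κ n θ) (Process.exitTime (sleArgLevel κ n θ) α β) ω))) := by
    filter_upwards [ae_ne_top_of_le_sleExitLevel hκ hτσ] with ω hω
    obtain ⟨T, hT⟩ := WithTop.ne_top_iff_exists.1 hω
    refine tendsto_const_nhds.congr' ?_
    obtain ⟨N, hN⟩ := exists_nat_ge (T : ℝ)
    filter_upwards [eventually_ge_atTop N] with k hk
    have hTk : (T : ℝ≥0) ≤ (k : ℝ≥0) := by
      rw [← NNReal.coe_le_coe]; push_cast; exact hN.trans (by exact_mod_cast hk)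
    have hsp : stoppedProcess (sleArgLevel κ n θ) (Process.exitTime (sleArgLevel κ n θ) α β) k ω =
        stoppedValue (sleArgLevel κ n θ) (Process.exitTime (sleArgLevel κ n θ) α β) ω := by
      rw [stoppedProcess_eq_of_ge (by rw [← hT]; exact_mod_cast hTk), stoppedValue, ← hT]
    rw [hsp, hFval]
    rcases stoppedValue_subExit_eq_or (κ := κ) (n := n) hθ hT.symm with h | h
    · rw [h]; exact ⟨le_rfl, (hθ.1.trans hθ.2).le⟩
    · rw [h]; exact ⟨(hθ.1.trans hθ.2).le, le_rfl⟩
  have hmeas : ∀ k : ℕ, AEStronglyMeasurable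
      (fun ω ↦ F (stoppedProcess (sleArgLevel κ n θ) (Process.exitTime (sleArgLevel κ n θ) α β) k ω))
      preWienerMeasure := fun k ↦
    (hF.continuous.measurable.comp ((stronglyAdapted_stoppedProcess_sleArgLevel κ n θ hτ k).measurable.mono
      (brownianFiltration.le _) le_rfl)).aestronglyMeasurable
  have hbound : ∀ k : ℕ, ∀ᵐ ω ∂preWienerMeasure,
      ‖F (stoppedProcess (sleArgLevel κ n θ) (Process.exitTime (sleArgLevel κ n θ) α β) k ω)‖ ≤ C :=
    fun k ↦ Eventually.of_forall fun ω ↦ hC _ (stoppedProcess_subExit_mem_Icc hθ k ω)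
  have hdct := tendsto_integral_of_dominated_convergence _ hmeas (integrable_const C) hbound hlim
  have h := tendsto_nhds_unique hdct (by simp only [hdyn]; exact tendsto_const_nhds)
  rw [h, hFval θ ⟨hθ.1.le, hθ.2.le⟩]

include hκ hα hβ hθ in
/-- **`P[Y_τ = α] = (s(β) - s(θ))/(s(β) - s(α))`** in the form
`P[Y_τ = α] (s(β) - s(α)) = s(β) - s(θ)`. [cite: Lawler2005, §1.11 Lemma 1.25] -/
theorem measureReal_stoppedValue_subExit_eq_mul :
    preWienerMeasure.real
        {ω | stoppedValue (sleArgLevel κ n θ) (Process.exitTime (sleArgLevel κ n θ) α β) ω = α} *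
      (sleScale κ β - sleScale κ α) = sleScale κ β - sleScale κ θ := by
  have h := integral_comp_stoppedValue_subExit hκ hα hβ hθ (sleScale κ)
  rw [integral_sleScale_stoppedValue_subExit hκ hα hβ hθ] at h
  linarith

/-- `Λ₀ (y ↦ (y - θ)²) = κ + 2 cot(y/2) (y - θ)`. [folklore] -/
theorem expGenerator_sq_sub (θ y : ℝ) :
    expGenerator κ 0 (fun y ↦ (y - θ) ^ 2) y = κ + 2 * Real.cot (y / 2) * (y - θ) := by
  have h1 : deriv (fun y : ℝ ↦ (y - θ) ^ 2) = fun y ↦ 2 * (y - θ) := by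
    funext y; simp
  have h2 : iteratedDeriv 2 (fun y : ℝ ↦ (y - θ) ^ 2) y = 2 := by
    rw [iteratedDeriv_succ, iteratedDeriv_one, h1]; simp
  rw [expGenerator_apply, h2, h1]
  ring

include hκ hα hβ hθ in
/-- **`E[τ ∧ t] ≤ (2/κ) E[(Y_{t∧τ} - θ)²]` on a short interval**: if `|cot(y/2) (y - θ)| ≤ κ/4`
on `[α, β]`, then `Λ₀ (· - θ)² ≥ κ/2` there and Dynkin's formula at `τ` for `(y - θ)²` bounds the
expected stopped time. [folklore] -/
theorem integral_min_subExit_le (hcot : ∀ y ∈ Icc α β, |Real.cot (y / 2) * (y - θ)| ≤ κ / 4) (t : ℝ≥0) :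
    ∫ ω, (((min (t : WithTop ℝ≥0) (Process.exitTime (sleArgLevel κ n θ) α β ω)).untopA : ℝ≥0) : ℝ)
        ∂preWienerMeasure ≤
      2 / κ * ∫ ω, (stoppedProcess (sleArgLevel κ n θ) (Process.exitTime (sleArgLevel κ n θ) α β) t ω - θ) ^ 2
        ∂preWienerMeasure := by
  haveI := isProbabilityMeasure_preWienerMeasure'
  have hκ0 : (0 : ℝ) < κ := lt_trans (by norm_num) (show (4 : ℝ) < κ by exact_mod_cast hκ)
  have hθn : θ ∈ Ioo (2 * level n) (2 * Real.pi - 2 * level n) :=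
    ⟨lt_of_le_of_lt hα hθ.1, lt_of_lt_of_le hθ.2 hβ⟩
  have hτ := isStoppingTime_subExit (κ := κ) (n := n) (θ := θ) α β
  have hτσ := subExit_le_sleExitLevel (κ := κ) (n := n) (θ := θ) hα hβ
  have hF : ContDiff ℝ 2 (fun y : ℝ ↦ (y - θ) ^ 2) := (contDiff_id.sub contDiff_const).pow 2
  have hdyn := integral_apply_stoppedProcess_eq hθn hF hτ hτσ t
  simp only [sub_self, ne_eq, OfNat.ofNat_ne_zero, not_false_eq_true, zero_pow, zero_add] at hdyn
  -- the generator is `≥ κ/2` along the path before `τ`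
  have hlow : ∀ ω, κ / 2 * (((min (t : WithTop ℝ≥0) (Process.exitTime (sleArgLevel κ n θ) α β ω)).untopA : ℝ≥0) : ℝ) ≤
      ∫ s in (0 : ℝ)..(((min (t : WithTop ℝ≥0) (Process.exitTime (sleArgLevel κ n θ) α β ω)).untopA : ℝ≥0) : ℝ),
        expGenerator κ 0 (fun y ↦ (y - θ) ^ 2) (sleArgLevel κ n θ s.toNNReal ω) := by
    intro ω
    set r := (((min (t : WithTop ℝ≥0) (Process.exitTime (sleArgLevel κ n θ) α β ω)).untopA : ℝ≥0) : ℝ) with hr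
    have hr0 : 0 ≤ r := NNReal.coe_nonneg _
    have hge : ∀ s ∈ Icc 0 r, κ / 2 ≤ expGenerator κ 0 (fun y ↦ (y - θ) ^ 2) (sleArgLevel κ n θ s.toNNReal ω) := by
      intro s hs
      have hsτ : ((s.toNNReal : ℝ≥0) : WithTop ℝ≥0) ≤ Process.exitTime (sleArgLevel κ n θ) α β ω :=
        (WithTop.coe_le_coe.2 ((Real.toNNReal_le_iff_le_coe).2 hs.2)).trans (coe_untopA_min_le _ _)
      have hmem : sleArgLevel κ n θ s.toNNReal ω ∈ Icc α β := by
        have := stoppedProcess_subExit_mem_Icc (κ := κ) (n := n) hθ s.toNNReal ω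
        rwa [stoppedProcess_eq_of_le hsτ] at this
      rw [expGenerator_sq_sub]
      have h := hcot _ hmem
      have h' : -(κ / 4 : ℝ) ≤ Real.cot (sleArgLevel κ n θ s.toNNReal ω / 2) * (sleArgLevel κ n θ s.toNNReal ω - θ) :=
        (abs_le.1 h).1
      linarith
    have hcont : ContinuousOn (fun s ↦ expGenerator κ 0 (fun y ↦ (y - θ) ^ 2) (sleArgLevel κ n θ s.toNNReal ω))
        (Icc 0 r) := by
      have hc1 : Continuous fun s : ℝ ↦ sleArgLevel κ n θ s.toNNReal ω :=
        (continuous_sleArgLevel κ n θ ω).comp continuous_real_toNNReal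
      refine (continuousOn_expGenerator κ 0 hF).comp hc1.continuousOn fun s hs ↦ ?_
      have hsτ : ((s.toNNReal : ℝ≥0) : WithTop ℝ≥0) ≤ Process.exitTime (sleArgLevel κ n θ) α β ω :=
        (WithTop.coe_le_coe.2 ((Real.toNNReal_le_iff_le_coe).2 hs.2)).trans (coe_untopA_min_le _ _)
      have hmem : sleArgLevel κ n θ s.toNNReal ω ∈ Icc α β := by
        have := stoppedProcess_subExit_mem_Icc (κ := κ) (n := n) hθ s.toNNReal ω
        rwa [stoppedProcess_eq_of_le hsτ] at this
      exact Icc_level_subset_Ioo n (Icc_subset_Icc hα hβ hmem)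
    have hmono := intervalIntegral.integral_mono_on hr0
      (intervalIntegrable_const (μ := volume) (c := (κ : ℝ) / 2))
      (hcont.intervalIntegrable_of_Icc hr0) (fun s hs ↦ hge s hs)
    rw [intervalIntegral.integral_const, smul_eq_mul, sub_zero] at hmono
    linarith
  have hmeasr : Measurable fun ω ↦ (((min (t : WithTop ℝ≥0)
      (Process.exitTime (sleArgLevel κ n θ) α β ω)).untopA : ℝ≥0) : ℝ) := by
    have h := ((isStoppingTime_const brownianFiltration t).min hτ).measurable'.untopA.coe_nnreal_real
    exact h
  have hri : Integrable (fun ω ↦ (((min (t : WithTop ℝ≥0) (Process.exitTime (sleArgLevel κ n θ) α β ω)).untopA : ℝ≥0) : ℝ)) preWienerMeasure := by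
    refine integrable_of_abs_le hmeasr (C := t) fun ω ↦ ?_
    rw [abs_of_nonneg (NNReal.coe_nonneg _)]
    exact_mod_cast untopA_min_coe_le t (Process.exitTime (sleArgLevel κ n θ) α β ω)
  -- integrability of the right side: from the identity
  have hVmeas : Measurable fun ω ↦ stoppedProcess (sleArgLevel κ n θ) (Process.exitTime (sleArgLevel κ n θ) α β) t ω :=
    (stronglyAdapted_stoppedProcess_sleArgLevel κ n θ hτ t).measurable.mono (brownianFiltration.le t) le_rfl
  have hsq : Integrable (fun ω ↦ (stoppedProcess (sleArgLevel κ n θ) (Process.exitTime (sleArgLevel κ n θ) α β) t ω - θ) ^ 2) preWienerMeasure := by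
    refine integrable_of_abs_le ((hVmeas.sub measurable_const).pow_const 2) (C := (β - α) ^ 2) fun ω ↦ ?_
    have hm := stoppedProcess_subExit_mem_Icc (κ := κ) (n := n) hθ t ω
    rw [abs_of_nonneg (sq_nonneg _), sq_le_sq, abs_of_nonneg (by linarith [hθ.1, hθ.2] : (0 : ℝ) ≤ β - α)]
    exact abs_le.2 ⟨by linarith [hm.1, hθ.2], by linarith [hm.2, hθ.1]⟩
  have hIi := integrable_intervalIntegral_expGenerator hθn hF hτ hτσ t
  have hmono := integral_mono (hri.const_mul ((κ : ℝ) / 2)) hIi hlow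
  rw [integral_const_mul, ← hdyn] at hmono
  rw [div_mul_eq_mul_div, le_div_iff₀ hκ0]
  linarith

/-- `(s ∧ x).untopA ≤ (t ∧ x).untopA` for `s ≤ t`. [folklore] -/
theorem untopA_min_mono {s t : ℝ≥0} (hst : s ≤ t) (x : WithTop ℝ≥0) :
    (min (s : WithTop ℝ≥0) x).untopA ≤ (min (t : WithTop ℝ≥0) x).untopA := by
  induction x using WithTop.recTopCoe with
  | top => rw [min_eq_left le_top, min_eq_left le_top]; exact hst
  | coe r => rw [← WithTop.coe_min, ← WithTop.coe_min]; exact min_le_min_right r hst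

include hκ hα hβ hθ in
/-- **`E[τ ∧ 1] ≤ (2/κ) E[(Y_τ - θ)²] = (2/κ) ((θ - α)² P[Y_τ = α] + (β - θ)² P[Y_τ = β])` on a short
interval** (let `t → ∞` in `integral_min_subExit_le`: `Y_{t∧τ} → Y_τ ∈ {α, β}` a.s., bounded
convergence). [folklore] -/
theorem integral_min_one_subExit_le (hcot : ∀ y ∈ Icc α β, |Real.cot (y / 2) * (y - θ)| ≤ κ / 4) :
    ∫ ω, (((min ((1 : ℝ≥0) : WithTop ℝ≥0) (Process.exitTime (sleArgLevel κ n θ) α β ω)).untopA : ℝ≥0) : ℝ)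
        ∂preWienerMeasure ≤
      2 / κ * ((θ - α) ^ 2 * preWienerMeasure.real
        {ω | stoppedValue (sleArgLevel κ n θ) (Process.exitTime (sleArgLevel κ n θ) α β) ω = α} +
        (β - θ) ^ 2 * (1 - preWienerMeasure.real
        {ω | stoppedValue (sleArgLevel κ n θ) (Process.exitTime (sleArgLevel κ n θ) α β) ω = α})) := by
  haveI := isProbabilityMeasure_preWienerMeasure'
  have hκ0 : (0 : ℝ) < κ := lt_trans (by norm_num) (show (4 : ℝ) < κ by exact_mod_cast hκ)
  have hτ := isStoppingTime_subExit (κ := κ) (n := n) (θ := θ) α β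
  have hτσ := subExit_le_sleExitLevel (κ := κ) (n := n) (θ := θ) hα hβ
  -- `E[1 ∧ τ] ≤ E[k ∧ τ] ≤ (2/κ) E[(Y_{k∧τ} - θ)²]` for `k ≥ 1`
  have hstep : ∀ k : ℕ, 1 ≤ k →
      ∫ ω, (((min ((1 : ℝ≥0) : WithTop ℝ≥0) (Process.exitTime (sleArgLevel κ n θ) α β ω)).untopA : ℝ≥0) : ℝ)
        ∂preWienerMeasure ≤
      2 / κ * ∫ ω, (stoppedProcess (sleArgLevel κ n θ) (Process.exitTime (sleArgLevel κ n θ) α β) k ω - θ) ^ 2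
        ∂preWienerMeasure := by
    intro k hk
    refine le_trans (integral_mono_of_nonneg (Eventually.of_forall fun ω ↦ NNReal.coe_nonneg _) ?_
      (Eventually.of_forall fun ω ↦ ?_)) (integral_min_subExit_le hκ hα hβ hθ hcot k)
    · have hm : Measurable fun ω ↦ (((min ((k : ℝ≥0) : WithTop ℝ≥0)
          (Process.exitTime (sleArgLevel κ n θ) α β ω)).untopA : ℝ≥0) : ℝ) := by
        have h := ((isStoppingTime_const brownianFiltration (k : ℝ≥0)).min hτ).measurable'.untopA.coe_nnreal_real
        exact h
      refine integrable_of_abs_le hm (C := k) fun ω ↦ ?_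
      rw [abs_of_nonneg (NNReal.coe_nonneg _)]
      exact_mod_cast untopA_min_coe_le (k : ℝ≥0) _
    · exact_mod_cast untopA_min_mono (by exact_mod_cast hk : (1 : ℝ≥0) ≤ k) _
  -- the right side converges to `(2/κ) E[(Y_τ - θ)²]`
  set g : ℝ → ℝ := fun y ↦ (y - θ) ^ 2 with hg
  have hgc : Continuous g := (continuous_id.sub continuous_const).pow 2
  have hlim : ∀ᵐ ω ∂preWienerMeasure, Tendsto (fun k : ℕ ↦ g (stoppedProcess (sleArgLevel κ n θ)
      (Process.exitTime (sleArgLevel κ n θ) α β) k ω)) atTop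
      (𝓝 (g (stoppedValue (sleArgLevel κ n θ) (Process.exitTime (sleArgLevel κ n θ) α β) ω))) := by
    filter_upwards [ae_ne_top_of_le_sleExitLevel hκ hτσ] with ω hω
    obtain ⟨T, hT⟩ := WithTop.ne_top_iff_exists.1 hω
    refine tendsto_const_nhds.congr' ?_
    obtain ⟨N, hN⟩ := exists_nat_ge (T : ℝ)
    filter_upwards [eventually_ge_atTop N] with k hk
    have hTk : (T : ℝ≥0) ≤ (k : ℝ≥0) := by
      rw [← NNReal.coe_le_coe]; push_cast; exact hN.trans (by exact_mod_cast hk)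
    rw [stoppedProcess_eq_of_ge (by rw [← hT]; exact_mod_cast hTk), stoppedValue, ← hT]
  have hmeas : ∀ k : ℕ, AEStronglyMeasurable (fun ω ↦ g (stoppedProcess (sleArgLevel κ n θ)
      (Process.exitTime (sleArgLevel κ n θ) α β) k ω)) preWienerMeasure := fun k ↦
    (hgc.measurable.comp ((stronglyAdapted_stoppedProcess_sleArgLevel κ n θ hτ k).measurable.mono
      (brownianFiltration.le _) le_rfl)).aestronglyMeasurable
  have hbound : ∀ k : ℕ, ∀ᵐ ω ∂preWienerMeasure, ‖g (stoppedProcess (sleArgLevel κ n θ)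
      (Process.exitTime (sleArgLevel κ n θ) α β) k ω)‖ ≤ (β - α) ^ 2 := fun k ↦
    Eventually.of_forall fun ω ↦ by
      have hm := stoppedProcess_subExit_mem_Icc (κ := κ) (n := n) hθ k ω
      rw [Real.norm_eq_abs, hg, abs_of_nonneg (sq_nonneg _), sq_le_sq,
        abs_of_nonneg (by linarith [hθ.1, hθ.2] : (0 : ℝ) ≤ β - α)]
      exact abs_le.2 ⟨by linarith [hm.1, hθ.2], by linarith [hm.2, hθ.1]⟩
  have hdct := tendsto_integral_of_dominated_convergence _ hmeas (integrable_const _) hbound hlim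
  have hle := ge_of_tendsto (hdct.const_mul ((2 : ℝ) / κ))
    (Filter.eventually_atTop.2 ⟨1, fun k hk ↦ hstep k hk⟩)
  refine hle.trans (le_of_eq ?_)
  rw [integral_comp_stoppedValue_subExit hκ hα hβ hθ g]
  simp only [hg]
  ring

end SubExit

/-! ### Continuity of the exit functionals -/

section Continuity

variable (hκ : 4 < κ)
include hκ

/-- **The oscillation term.** For a bounded continuous `φ`, a level `n` containing `θ`, a stopping
time `τ ≤ σₙ`, and `K`, `δ ∈ (0, 1)`, `δ'` with `δ < δ'` such that `φ` varies by less than `ε'` on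
points of `[-1, K + 1]` at distance `< δ'`:
`E|φ(T - τ) - φ(T)| ≤ ε' + 2C (P[K < T] + E[τ ∧ 1]/δ)`. [folklore] -/
theorem integral_abs_comp_sub_le
    {φ : ℝ → ℝ} (hφc : Continuous φ) {C : ℝ} (hφb : ∀ t, |φ t| ≤ C)
    {τ : (ℝ≥0 → ℝ) → WithTop ℝ≥0} (hτ : IsStoppingTime brownianFiltration τ)
    (hτσ : ∀ ω, τ ω ≤ sleExitLevel κ n θ ω) {K : ℝ≥0} {δ δ' ε' : ℝ} (hδ0 : 0 < δ) (hδ1 : δ < 1)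
    (hδδ' : δ < δ') (hε' : 0 ≤ ε')
    (hunif : ∀ x ∈ Icc (-1 : ℝ) (K + 1), ∀ y ∈ Icc (-1 : ℝ) (K + 1), dist x y < δ' → dist (φ x) (φ y) < ε') :
    ∫ ω, |φ (sleLifetimeReal κ θ ω - ((τ ω).untopA : ℝ≥0)) - φ (sleLifetimeReal κ θ ω)| ∂preWienerMeasure ≤
      ε' + 2 * C * (preWienerMeasure.real {ω | (K : WithTop ℝ≥0) < sleLifetime κ θ ω} +
        (∫ ω, (((min ((1 : ℝ≥0) : WithTop ℝ≥0) (τ ω)).untopA : ℝ≥0) : ℝ) ∂preWienerMeasure) / δ) := by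
  haveI := isProbabilityMeasure_preWienerMeasure'
  have hC : 0 ≤ C := (abs_nonneg _).trans (hφb 0)
  have hfin : ∀ᵐ ω ∂preWienerMeasure, τ ω ≠ ⊤ := ae_ne_top_of_le_sleExitLevel hκ hτσ
  -- the bad event
  set B₁ := {ω : ℝ≥0 → ℝ | (K : WithTop ℝ≥0) < sleLifetime κ θ ω} with hB₁
  set m : (ℝ≥0 → ℝ) → ℝ := fun ω ↦ (((min ((1 : ℝ≥0) : WithTop ℝ≥0) (τ ω)).untopA : ℝ≥0) : ℝ) with hm
  set B₂ := {ω : ℝ≥0 → ℝ | δ ≤ m ω} with hB₂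
  have hB₁m : MeasurableSet B₁ := measurableSet_lt_sleLifetime κ θ K
  have hmm : Measurable m := by
    have h := ((isStoppingTime_const brownianFiltration (1 : ℝ≥0)).min hτ).measurable'.untopA.coe_nnreal_real
    exact h
  have hB₂m : MeasurableSet B₂ := measurableSet_le measurable_const hmm
  -- pointwise bound
  have hpt : ∀ᵐ ω ∂preWienerMeasure,
      |φ (sleLifetimeReal κ θ ω - ((τ ω).untopA : ℝ≥0)) - φ (sleLifetimeReal κ θ ω)| ≤
        ε' + 2 * C * (B₁ ∪ B₂).indicator 1 ω := by
    filter_upwards [hfin] with ω hτω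
    obtain ⟨r, hr⟩ := WithTop.ne_top_iff_exists.1 hτω
    have hru : (((τ ω).untopA : ℝ≥0) : ℝ) = r := coe_untopA_of_eq_coe hr.symm
    by_cases hω : ω ∈ B₁ ∪ B₂
    · rw [indicator_of_mem hω, Pi.one_apply, mul_one]
      have h1 := hφb (sleLifetimeReal κ θ ω - ((τ ω).untopA : ℝ≥0))
      have h2 := hφb (sleLifetimeReal κ θ ω)
      have := abs_sub _ _ |>.trans (add_le_add h1 h2)
      linarith
    · rw [indicator_of_notMem hω, mul_zero, add_zero]
      rw [Set.mem_union, not_or] at hω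
      obtain ⟨hω1, hω2⟩ := hω
      -- `T ≤ K` and `τ < δ`
      have hTK : sleLifetimeReal κ θ ω ≤ K := by
        have hle : sleLifetime κ θ ω ≤ (K : WithTop ℝ≥0) := not_lt.1 hω1
        obtain ⟨t, ht⟩ := WithTop.ne_top_iff_exists.1 (ne_top_of_le_ne_top WithTop.coe_ne_top hle)
        rw [← ht, WithTop.coe_le_coe] at hle
        rw [sleLifetimeReal_of_eq_coe ht.symm]; exact_mod_cast hle
      have hτδ : (r : ℝ) < δ := by
        have hlt : m ω < δ := not_le.1 hω2
        have hmr : m ω = min (1 : ℝ) r := by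
          simp only [hm, ← hr, ← WithTop.coe_min]
          rfl
        rw [hmr] at hlt
        rcases min_lt_iff.1 hlt with h | h
        · linarith
        · exact h
      have hT0 := sleLifetimeReal_nonneg κ θ ω
      have hr0 : (0 : ℝ) ≤ r := r.coe_nonneg
      rw [hru]
      have hx : sleLifetimeReal κ θ ω - r ∈ Icc (-1 : ℝ) (K + 1) := ⟨by linarith, by linarith⟩
      have hy : sleLifetimeReal κ θ ω ∈ Icc (-1 : ℝ) (K + 1) := ⟨by linarith, by linarith⟩
      have hd : dist (sleLifetimeReal κ θ ω - r) (sleLifetimeReal κ θ ω) < δ' := by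
        rw [Real.dist_eq, show sleLifetimeReal κ θ ω - r - sleLifetimeReal κ θ ω = -r by ring, abs_neg,
          abs_of_nonneg hr0]
        linarith
      have := hunif _ hx _ hy hd
      rw [Real.dist_eq] at this
      exact this.le
  -- integrate
  have hint_rhs : Integrable (fun ω ↦ ε' + 2 * C * (B₁ ∪ B₂).indicator (1 : (ℝ≥0 → ℝ) → ℝ) ω)
      preWienerMeasure :=
    (integrable_const _).add (((integrable_const (1 : ℝ)).indicator (hB₁m.union hB₂m)).const_mul _)
  have hmeasL : AEStronglyMeasurable (fun ω ↦ |φ (sleLifetimeReal κ θ ω - ((τ ω).untopA : ℝ≥0)) -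
      φ (sleLifetimeReal κ θ ω)|) preWienerMeasure := by
    refine (Measurable.aestronglyMeasurable ?_)
    exact ((hφc.measurable.comp ((measurable_sleLifetimeReal κ θ).sub hτ.measurable'.untopA.coe_nnreal_real)).sub
      (hφc.measurable.comp (measurable_sleLifetimeReal κ θ))).abs
  have hint_lhs : Integrable (fun ω ↦ |φ (sleLifetimeReal κ θ ω - ((τ ω).untopA : ℝ≥0)) -
      φ (sleLifetimeReal κ θ ω)|) preWienerMeasure := by
    refine (integrable_const (2 * C)).mono' hmeasL (Eventually.of_forall fun ω ↦ ?_)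
    rw [Real.norm_eq_abs, abs_abs]
    have h1 := hφb (sleLifetimeReal κ θ ω - ((τ ω).untopA : ℝ≥0))
    have h2 := hφb (sleLifetimeReal κ θ ω)
    have := abs_sub _ _ |>.trans (add_le_add h1 h2)
    linarith
  refine (integral_mono_ae hint_lhs hint_rhs hpt).trans ?_
  have h2 : Integrable (fun ω ↦ 2 * C * (B₁ ∪ B₂).indicator (1 : (ℝ≥0 → ℝ) → ℝ) ω) preWienerMeasure :=
    ((integrable_const (1 : ℝ)).indicator (hB₁m.union hB₂m)).const_mul (2 * C)
  rw [integral_add (integrable_const _) h2, integral_const, smul_eq_mul, probReal_univ, one_mul,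
    integral_const_mul, integral_indicator_one (hB₁m.union hB₂m)]
  have hCC : (0 : ℝ) ≤ 2 * C := by positivity
  refine add_le_add le_rfl (mul_le_mul_of_nonneg_left ?_ hCC)
  refine (measureReal_union_le B₁ B₂).trans (add_le_add le_rfl ?_)
  -- Markov for `m`
  have hmk := mul_meas_ge_le_integral_of_nonneg (μ := preWienerMeasure)
    (Eventually.of_forall fun ω ↦ (NNReal.coe_nonneg _ : 0 ≤ m ω)) ?_ δ
  · rw [le_div_iff₀ hδ0, mul_comm]; exact hmk
  · refine integrable_of_abs_le hmm (C := 1) fun ω ↦ ?_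
    rw [abs_of_nonneg (NNReal.coe_nonneg _)]
    exact_mod_cast untopA_min_coe_le (1 : ℝ≥0) (τ ω)

/-- **The two-sided estimate from the mean-value property.** Let `θ ∈ (α, β)` with `[α, β]` in
the level-`n` interval and `|cot(y/2)(y - θ)| ≤ κ/4` on `[α, β]`; let `a` be bounded by `C`, and
suppose the mean-value property `E[a(Y_ρ)] = E[φ(T - ρ); S]` holds for all stopping times
`ρ ≤ σₙ(θ)` (`φ` continuous bounded by `C`, `S` an event). Then, with `p = P[Y_τ = α]` (`τ` the exit
time from `(α, β)`), `|a(β) - a(θ)| ≤ 2C p + R` and `|a(α) - a(θ)| ≤ 2C (1 - p) + R`, where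
`R = ε' + 2C (P[K < T] + (2/κ)((θ - α)² p + (β - θ)² (1 - p))/δ)` for any admissible oscillation data
`(K, δ, δ', ε')` of `φ`. [folklore] -/
theorem abs_sub_le_of_meanValue
    {α β : ℝ} (hα : 2 * level n ≤ α) (hβ : β ≤ 2 * Real.pi - 2 * level n) (hθ : θ ∈ Ioo α β)
    (hcot : ∀ y ∈ Icc α β, |Real.cot (y / 2) * (y - θ)| ≤ κ / 4)
    {a : ℝ → ℝ} {C : ℝ} (hab : ∀ y, |a y| ≤ C) {S : Set (ℝ≥0 → ℝ)} (hS : MeasurableSet S)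
    {φ : ℝ → ℝ} (hφc : Continuous φ) (hφb : ∀ t, |φ t| ≤ C)
    (hMV : ∀ {ρ : (ℝ≥0 → ℝ) → WithTop ℝ≥0}, IsStoppingTime brownianFiltration ρ →
      (∀ ω, ρ ω ≤ sleExitLevel κ n θ ω) →
      ∫ ω, a (stoppedValue (sleArgLevel κ n θ) ρ ω) ∂preWienerMeasure =
        ∫ ω, S.indicator (fun ω ↦ φ (sleLifetimeReal κ θ ω - ((ρ ω).untopA : ℝ≥0))) ω ∂preWienerMeasure)
    {K : ℝ≥0} {δ δ' ε' : ℝ} (hδ0 : 0 < δ) (hδ1 : δ < 1) (hδδ' : δ < δ') (hε' : 0 ≤ ε')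
    (hunif : ∀ x ∈ Icc (-1 : ℝ) (K + 1), ∀ y ∈ Icc (-1 : ℝ) (K + 1), dist x y < δ' → dist (φ x) (φ y) < ε') :
    |a β - a θ| ≤ 2 * C * preWienerMeasure.real
        {ω | stoppedValue (sleArgLevel κ n θ) (Process.exitTime (sleArgLevel κ n θ) α β) ω = α} +
      (ε' + 2 * C * (preWienerMeasure.real {ω | (K : WithTop ℝ≥0) < sleLifetime κ θ ω} +
        (2 / κ * ((θ - α) ^ 2 * preWienerMeasure.real
          {ω | stoppedValue (sleArgLevel κ n θ) (Process.exitTime (sleArgLevel κ n θ) α β) ω = α} +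
          (β - θ) ^ 2 * (1 - preWienerMeasure.real
          {ω | stoppedValue (sleArgLevel κ n θ) (Process.exitTime (sleArgLevel κ n θ) α β) ω = α}))) / δ)) ∧
    |a α - a θ| ≤ 2 * C * (1 - preWienerMeasure.real
        {ω | stoppedValue (sleArgLevel κ n θ) (Process.exitTime (sleArgLevel κ n θ) α β) ω = α}) +
      (ε' + 2 * C * (preWienerMeasure.real {ω | (K : WithTop ℝ≥0) < sleLifetime κ θ ω} +
        (2 / κ * ((θ - α) ^ 2 * preWienerMeasure.real
          {ω | stoppedValue (sleArgLevel κ n θ) (Process.exitTime (sleArgLevel κ n θ) α β) ω = α} +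
          (β - θ) ^ 2 * (1 - preWienerMeasure.real
          {ω | stoppedValue (sleArgLevel κ n θ) (Process.exitTime (sleArgLevel κ n θ) α β) ω = α}))) / δ)) := by
  haveI := isProbabilityMeasure_preWienerMeasure'
  have hC : 0 ≤ C := (abs_nonneg _).trans (hφb 0)
  have hτ := isStoppingTime_subExit (κ := κ) (n := n) (θ := θ) α β
  have hτσ := subExit_le_sleExitLevel (κ := κ) (n := n) (θ := θ) hα hβ
  set τ := Process.exitTime (sleArgLevel κ n θ) α β with hτdef
  set p := preWienerMeasure.real {ω | stoppedValue (sleArgLevel κ n θ) τ ω = α} with hp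
  have hp0 : 0 ≤ p := measureReal_nonneg
  have hp1 : p ≤ 1 := measureReal_le_one
  -- (1) the two-point decomposition
  have h1 := integral_comp_stoppedValue_subExit hκ hα hβ hθ a
  -- (2) mean value at `τ` and at `0`
  have h2 := hMV hτ hτσ
  have h3 : a θ = ∫ ω, S.indicator (fun ω ↦ φ (sleLifetimeReal κ θ ω)) ω ∂preWienerMeasure := by
    have h := hMV (isStoppingTime_const brownianFiltration 0) (fun ω ↦ bot_le)
    have hl : ∀ ω, stoppedValue (sleArgLevel κ n θ) (fun _ ↦ ((0 : ℝ≥0) : WithTop ℝ≥0)) ω = θ := fun ω ↦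
      argTrunc_zero _ _ _ θ ω
    have hr : ∀ ω, sleLifetimeReal κ θ ω - ((((fun _ : ℝ≥0 → ℝ ↦ ((0 : ℝ≥0) : WithTop ℝ≥0)) ω).untopA : ℝ≥0) : ℝ) =
        sleLifetimeReal κ θ ω := fun ω ↦ by
      change sleLifetimeReal κ θ ω - (((0 : ℝ≥0) : ℝ)) = _
      rw [NNReal.coe_zero, sub_zero]
    simp only [hl, hr, integral_const, smul_eq_mul, probReal_univ, one_mul] at h
    exact h
  -- (3) the oscillation bound
  have hi1 : Integrable (fun ω ↦ S.indicator (fun ω ↦ φ (sleLifetimeReal κ θ ω - ((τ ω).untopA : ℝ≥0))) ω)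
      preWienerMeasure := by
    refine (integrable_const C).mono' ?_ (Eventually.of_forall fun ω ↦ ?_)
    · exact ((hφc.measurable.comp ((measurable_sleLifetimeReal κ θ).sub
        hτ.measurable'.untopA.coe_nnreal_real)).indicator hS).aestronglyMeasurable
    · rw [Real.norm_eq_abs]
      by_cases hω : ω ∈ S
      · rw [indicator_of_mem hω]; exact hφb _
      · rw [indicator_of_notMem hω, abs_zero]; exact hC
  have hi2 : Integrable (fun ω ↦ S.indicator (fun ω ↦ φ (sleLifetimeReal κ θ ω)) ω) preWienerMeasure := by
    refine (integrable_const C).mono' ?_ (Eventually.of_forall fun ω ↦ ?_)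
    · exact ((hφc.measurable.comp (measurable_sleLifetimeReal κ θ)).indicator hS).aestronglyMeasurable
    · rw [Real.norm_eq_abs]
      by_cases hω : ω ∈ S
      · rw [indicator_of_mem hω]; exact hφb _
      · rw [indicator_of_notMem hω, abs_zero]; exact hC
  have h4 : |(∫ ω, S.indicator (fun ω ↦ φ (sleLifetimeReal κ θ ω - ((τ ω).untopA : ℝ≥0))) ω ∂preWienerMeasure) -
      ∫ ω, S.indicator (fun ω ↦ φ (sleLifetimeReal κ θ ω)) ω ∂preWienerMeasure| ≤
      ∫ ω, |φ (sleLifetimeReal κ θ ω - ((τ ω).untopA : ℝ≥0)) - φ (sleLifetimeReal κ θ ω)| ∂preWienerMeasure := by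
    rw [← integral_sub hi1 hi2]
    refine (abs_integral_le_integral_abs).trans (integral_mono_of_nonneg (Eventually.of_forall fun _ ↦ abs_nonneg _)
      ?_ (Eventually.of_forall fun ω ↦ ?_))
    · refine (integrable_const (2 * C)).mono' ?_ (Eventually.of_forall fun ω ↦ ?_)
      · exact (((hφc.measurable.comp ((measurable_sleLifetimeReal κ θ).sub
          hτ.measurable'.untopA.coe_nnreal_real)).sub (hφc.measurable.comp (measurable_sleLifetimeReal κ θ))).abs).aestronglyMeasurable
      · rw [Real.norm_eq_abs, abs_abs]
        have h1 := hφb (sleLifetimeReal κ θ ω - ((τ ω).untopA : ℝ≥0))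
        have h2 := hφb (sleLifetimeReal κ θ ω)
        have := abs_sub _ _ |>.trans (add_le_add h1 h2)
        linarith
    · change |S.indicator _ ω - S.indicator _ ω| ≤ _
      by_cases hω : ω ∈ S
      · rw [indicator_of_mem hω, indicator_of_mem hω]
      · rw [indicator_of_notMem hω, indicator_of_notMem hω, sub_zero, abs_zero]; exact abs_nonneg _
  have h5 := integral_abs_comp_sub_le hκ hφc hφb hτ hτσ (K := K) hδ0 hδ1 hδδ' hε' hunif
  have h6 := integral_min_one_subExit_le hκ hα hβ hθ hcot
  -- the common remainder
  have hR : |(∫ ω, a (stoppedValue (sleArgLevel κ n θ) τ ω) ∂preWienerMeasure) - a θ| ≤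
      ε' + 2 * C * (preWienerMeasure.real {ω | (K : WithTop ℝ≥0) < sleLifetime κ θ ω} +
        (2 / κ * ((θ - α) ^ 2 * p + (β - θ) ^ 2 * (1 - p))) / δ) := by
    rw [h2, h3]
    refine (h4.trans h5).trans ?_
    have hCC : (0 : ℝ) ≤ 2 * C := by positivity
    refine add_le_add le_rfl (mul_le_mul_of_nonneg_left (add_le_add le_rfl ?_) hCC)
    exact div_le_div_of_nonneg_right h6 hδ0.le
  have haβ := hab β
  have haα := hab α
  constructor
  · have hsplit : a β - a θ = p * (a β - a α) +
        ((∫ ω, a (stoppedValue (sleArgLevel κ n θ) τ ω) ∂preWienerMeasure) - a θ) := by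
      rw [h1]; ring
    rw [hsplit]
    refine (abs_add_le _ _).trans (add_le_add ?_ hR)
    rw [abs_mul, abs_of_nonneg hp0]
    have := (abs_sub _ _).trans (add_le_add haβ haα)
    nlinarith
  · have hsplit : a α - a θ = (1 - p) * (a α - a β) +
        ((∫ ω, a (stoppedValue (sleArgLevel κ n θ) τ ω) ∂preWienerMeasure) - a θ) := by
      rw [h1]; ring
    rw [hsplit]
    refine (abs_add_le _ _).trans (add_le_add ?_ hR)
    rw [abs_mul, abs_of_nonneg (by linarith)]
    have := (abs_sub _ _).trans (add_le_add haα haβ)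
    nlinarith

/-- **Continuity from the mean-value property.** Let `θ ∈ (0, 2π)`, let `a` be bounded by `C`, and
suppose that for every level `n` containing `θ` and every stopping time `ρ ≤ σₙ(θ)` the mean-value
property `E[a(Y_ρ)] = E[φ(T - ρ); S]` holds (`φ` continuous bounded by `C`, `S` an event). Then `a`
is continuous at `θ`. Quantitatively (`abs_sub_le_of_meanValue`), for `y` on either side of `θ`
the deviation `|a(y) - a(θ)|` is controlled by the probability of the far exit of the short
interval `(θ - η₀, y)` or `(y, θ + η₀)`, which is a ratio of increments of the continuous scale
function, by the tail `P[K < T]`, by an oscillation `ε'` of `φ` on `[-1, K + 1]`, and by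
`E[τ ∧ 1]/δ`, all small. [folklore] -/
theorem continuousAt_of_meanValue (hθ : θ ∈ Ioo 0 (2 * Real.pi))
    {a : ℝ → ℝ} {C : ℝ} (hab : ∀ y, |a y| ≤ C) {S : Set (ℝ≥0 → ℝ)} (hS : MeasurableSet S)
    {φ : ℝ → ℝ} (hφc : Continuous φ) (hφb : ∀ t, |φ t| ≤ C)
    (hMV : ∀ n : ℕ, θ ∈ Ioo (2 * level n) (2 * Real.pi - 2 * level n) →
      ∀ {ρ : (ℝ≥0 → ℝ) → WithTop ℝ≥0}, IsStoppingTime brownianFiltration ρ →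
      (∀ ω, ρ ω ≤ sleExitLevel κ n θ ω) →
      ∫ ω, a (stoppedValue (sleArgLevel κ n θ) ρ ω) ∂preWienerMeasure =
        ∫ ω, S.indicator (fun ω ↦ φ (sleLifetimeReal κ θ ω - ((ρ ω).untopA : ℝ≥0))) ω ∂preWienerMeasure) :
    ContinuousAt a θ := by
  haveI := isProbabilityMeasure_preWienerMeasure'
  have hC : 0 ≤ C := (abs_nonneg _).trans (hφb 0)
  have hκ0 : (0 : ℝ) < κ := lt_trans (by norm_num) (show (4 : ℝ) < κ by exact_mod_cast hκ)
  -- a level containing `θ`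
  obtain ⟨N, hN⟩ := eventually_mem_Ioo_level hθ
  have hθn := hN N le_rfl
  set ℓ := level N with hℓ
  have hℓ0 : 0 < ℓ := level_pos N
  -- cot bound on the closed level interval
  set M := Real.cot ℓ with hM
  have hM0 : 0 ≤ M := cot_level_nonneg hℓ0 (level_le N)
  have hcotb : ∀ y ∈ Icc (2 * ℓ) (2 * Real.pi - 2 * ℓ), |Real.cot (y / 2)| ≤ M := fun y hy ↦
    abs_cot_le_of_mem hℓ0 (level_le N) ⟨by linarith [hy.1], by linarith [hy.2]⟩
  -- the half-width `η₀`
  set η₁ := min (θ - 2 * ℓ) (2 * Real.pi - 2 * ℓ - θ) / 2 with hη₁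
  have hη₁0 : 0 < η₁ := by
    have := lt_min (sub_pos.2 hθn.1) (by linarith [hθn.2] : 0 < 2 * Real.pi - 2 * ℓ - θ)
    rw [hη₁]; linarith
  have hη₁a : 2 * ℓ < θ - η₁ := by
    have := min_le_left (θ - 2 * ℓ) (2 * Real.pi - 2 * ℓ - θ); rw [hη₁]; linarith
  have hη₁b : θ + η₁ < 2 * Real.pi - 2 * ℓ := by
    have := min_le_right (θ - 2 * ℓ) (2 * Real.pi - 2 * ℓ - θ); rw [hη₁]; linarith
  set η₀ := min η₁ (κ / (4 * (M + 1))) with hη₀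
  have hη₀0 : 0 < η₀ := lt_min hη₁0 (by positivity)
  have hη₀1 : η₀ ≤ η₁ := min_le_left _ _
  have hη₀2 : η₀ ≤ κ / (4 * (M + 1)) := min_le_right _ _
  -- interval data for `θ - η₀ ≤ α < θ < β ≤ θ + η₀`
  have hint : ∀ {α β : ℝ}, θ - η₀ ≤ α → β ≤ θ + η₀ →
      2 * ℓ ≤ α ∧ β ≤ 2 * Real.pi - 2 * ℓ ∧
      ∀ y ∈ Icc α β, |Real.cot (y / 2) * (y - θ)| ≤ κ / 4 := by
    intro α β hαθ hβθ
    refine ⟨by linarith, by linarith, fun y hy ↦ ?_⟩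
    have hyI : y ∈ Icc (2 * ℓ) (2 * Real.pi - 2 * ℓ) := ⟨by linarith [hy.1], by linarith [hy.2]⟩
    have h1 := hcotb y hyI
    have h2 : |y - θ| ≤ η₀ := abs_le.2 ⟨by linarith [hy.1], by linarith [hy.2]⟩
    rw [abs_mul]
    calc |Real.cot (y / 2)| * |y - θ| ≤ M * η₀ := mul_le_mul h1 h2 (abs_nonneg _) hM0
      _ ≤ (M + 1) * (κ / (4 * (M + 1))) := mul_le_mul (by linarith) hη₀2 hη₀0.le (by positivity)
      _ = κ / 4 := by field_simp
  -- the scale function near `θ`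
  have hsc := continuousOn_sleScale hκ
  have hsm := strictMonoOn_sleScale hκ
  have hθIcc : θ ∈ Icc 0 (2 * Real.pi) := ⟨hθ.1.le, hθ.2.le⟩
  have hmemIcc : ∀ {y : ℝ}, |y - θ| ≤ η₀ → y ∈ Icc 0 (2 * Real.pi) := fun {y} hy ↦ by
    have := abs_le.1 hy
    have hℓ1 := level_le_one N
    exact ⟨by linarith, by linarith⟩
  set d := sleScale κ θ - sleScale κ (θ - η₀) with hd
  set d' := sleScale κ (θ + η₀) - sleScale κ θ with hd'
  have hdpos : 0 < d := sub_pos.2 (hsm (hmemIcc (by rw [show θ - η₀ - θ = -η₀ by ring, abs_neg,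
    abs_of_pos hη₀0])) hθIcc (by linarith))
  have hd'pos : 0 < d' := sub_pos.2 (hsm hθIcc (hmemIcc (by rw [show θ + η₀ - θ = η₀ by ring,
    abs_of_pos hη₀0])) (by linarith))
  -- tail of `T`
  set f : ℕ → ℝ := fun K ↦ (tailConst κ + 1) / tailConst κ * Real.exp (-(tailRate κ * K)) with hf
  have hflim : Tendsto (fun K : ℕ ↦ (2 * C + 1) * f K) atTop (𝓝 0) := by
    rw [show (0 : ℝ) = (2 * C + 1) * ((tailConst κ + 1) / tailConst κ * 0) by ring]
    refine tendsto_const_nhds.mul (tendsto_const_nhds.mul ?_)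
    exact Real.tendsto_exp_atBot.comp (tendsto_neg_atTop_atBot.comp
      (tendsto_natCast_atTop_atTop.const_mul_atTop (tailRate_pos hκ)))
  -- ε-argument
  rw [Metric.continuousAt_iff]
  intro ε hε
  obtain ⟨K, hK⟩ := (hflim.eventually (gt_mem_nhds (by positivity : (0 : ℝ) < ε / 4))).exists
  have hPK : 2 * C * preWienerMeasure.real {ω | ((K : ℝ≥0) : WithTop ℝ≥0) < sleLifetime κ θ ω} < ε / 4 := by
    have h1 := measureReal_lt_sleLifetime_le (θ := θ) hκ (K : ℝ≥0)
    have hf0 : 0 ≤ f K := by rw [hf]; exact le_trans measureReal_nonneg h1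
    calc 2 * C * _ ≤ 2 * C * f K := mul_le_mul_of_nonneg_left h1 (by positivity)
      _ ≤ (2 * C + 1) * f K := by nlinarith
      _ < ε / 4 := hK
  -- uniform continuity of `φ` on `[-1, K + 1]`
  obtain ⟨δ', hδ'0, hunif⟩ := Metric.uniformContinuousOn_iff.1
    ((isCompact_Icc (a := (-1 : ℝ)) (b := (K : ℝ) + 1)).uniformContinuousOn_of_continuous hφc.continuousOn)
    (ε / 4) (by positivity)
  set δ := min (δ' / 2) (1 / 2) with hδ
  have hδ0 : 0 < δ := lt_min (by positivity) (by norm_num)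
  have hδ1 : δ < 1 := lt_of_le_of_lt (min_le_right _ _) (by norm_num)
  have hδδ' : δ < δ' := lt_of_le_of_lt (min_le_left _ _) (by linarith)
  have hunif' : ∀ x ∈ Icc (-1 : ℝ) ((K : ℝ≥0) + 1), ∀ y ∈ Icc (-1 : ℝ) ((K : ℝ≥0) + 1),
      dist x y < δ' → dist (φ x) (φ y) < ε / 4 := by
    intro x hx y hy hxy
    exact hunif x (by simpa using hx) y (by simpa using hy) hxy
  set PK := preWienerMeasure.real {ω | ((K : ℝ≥0) : WithTop ℝ≥0) < sleLifetime κ θ ω} with hPKdef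
  have hPK0 : 0 ≤ PK := measureReal_nonneg
  -- the two majorants
  set G : ℝ → ℝ := fun y ↦ 2 * C * ((sleScale κ y - sleScale κ θ) / d) +
    (ε / 4 + 2 * C * (PK + (2 / κ * (η₀ ^ 2 * ((sleScale κ y - sleScale κ θ) / d) + (y - θ) ^ 2)) / δ)) with hG
  set H : ℝ → ℝ := fun y ↦ 2 * C * ((sleScale κ θ - sleScale κ y) / d') +
    (ε / 4 + 2 * C * (PK + (2 / κ * ((θ - y) ^ 2 + η₀ ^ 2 * ((sleScale κ θ - sleScale κ y) / d'))) / δ)) with hH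
  have hsθ : ContinuousWithinAt (sleScale κ) (Icc 0 (2 * Real.pi)) θ := hsc θ hθIcc
  have hGc : ContinuousWithinAt G (Icc 0 (2 * Real.pi)) θ := by
    have h1 : ContinuousWithinAt (fun y ↦ (sleScale κ y - sleScale κ θ) / d) (Icc 0 (2 * Real.pi)) θ :=
      (hsθ.sub continuousWithinAt_const).div_const _
    have h2 : ContinuousWithinAt (fun y : ℝ ↦ (y - θ) ^ 2) (Icc 0 (2 * Real.pi)) θ :=
      ((continuousWithinAt_id.sub continuousWithinAt_const).pow 2)
    exact (continuousWithinAt_const.mul h1).add (continuousWithinAt_const.add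
      (continuousWithinAt_const.mul (continuousWithinAt_const.add
        ((continuousWithinAt_const.mul ((continuousWithinAt_const.mul h1).add h2)).div_const _))))
  have hHc : ContinuousWithinAt H (Icc 0 (2 * Real.pi)) θ := by
    have h1 : ContinuousWithinAt (fun y ↦ (sleScale κ θ - sleScale κ y) / d') (Icc 0 (2 * Real.pi)) θ :=
      (continuousWithinAt_const.sub hsθ).div_const _
    have h2 : ContinuousWithinAt (fun y : ℝ ↦ (θ - y) ^ 2) (Icc 0 (2 * Real.pi)) θ :=
      ((continuousWithinAt_const.sub continuousWithinAt_id).pow 2)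
    exact (continuousWithinAt_const.mul h1).add (continuousWithinAt_const.add
      (continuousWithinAt_const.mul (continuousWithinAt_const.add
        ((continuousWithinAt_const.mul (h2.add (continuousWithinAt_const.mul h1))).div_const _))))
  have hG0 : G θ < ε := by
    simp only [hG, sub_self, zero_div, mul_zero, zero_add, ne_eq, OfNat.ofNat_ne_zero,
      not_false_eq_true, zero_pow, add_zero]
    linarith
  have hH0 : H θ < ε := by
    simp only [hH, sub_self, zero_div, mul_zero, zero_add, ne_eq, OfNat.ofNat_ne_zero,
      not_false_eq_true, zero_pow, add_zero]
    linarith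
  have hGev : ∀ᶠ y in 𝓝 θ, y ∈ Icc 0 (2 * Real.pi) → G y < ε :=
    eventually_nhdsWithin_iff.1 (hGc.eventually (gt_mem_nhds hG0))
  have hHev : ∀ᶠ y in 𝓝 θ, y ∈ Icc 0 (2 * Real.pi) → H y < ε :=
    eventually_nhdsWithin_iff.1 (hHc.eventually (gt_mem_nhds hH0))
  have hnear : ∀ᶠ y in 𝓝 θ, |y - θ| < η₀ := by
    have := Metric.ball_mem_nhds θ hη₀0
    filter_upwards [this] with y hy
    rwa [Metric.mem_ball, Real.dist_eq] at hy
  obtain ⟨ρ₀, hρ₀, hball⟩ := Metric.eventually_nhds_iff.1 (hGev.and (hHev.and hnear))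
  refine ⟨ρ₀, hρ₀, fun y hy ↦ ?_⟩
  obtain ⟨hGy, hHy, hyθ⟩ := hball hy
  have hyIcc : y ∈ Icc 0 (2 * Real.pi) := hmemIcc hyθ.le
  rcases lt_trichotomy y θ with hlt | heq | hgt
  · -- left of `θ`: interval `(y, θ + η₀)`
    have hαβ := hint (α := y) (β := θ + η₀) (by linarith [(abs_lt.1 hyθ).1]) le_rfl
    have hθ' : θ ∈ Ioo y (θ + η₀) := ⟨hlt, by linarith⟩
    obtain ⟨-, hL⟩ := abs_sub_le_of_meanValue hκ hαβ.1 hαβ.2.1 hθ' hαβ.2.2 hab hS hφc hφb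
      (fun hρ hρσ ↦ hMV N hθn hρ hρσ) (K := K) hδ0 hδ1 hδδ' (by positivity) hunif'
    set p := preWienerMeasure.real {ω | stoppedValue (sleArgLevel κ N θ)
      (Process.exitTime (sleArgLevel κ N θ) y (θ + η₀)) ω = y} with hp
    have hp0 : 0 ≤ p := measureReal_nonneg
    have hp1 : p ≤ 1 := measureReal_le_one
    have hpeq := measureReal_stoppedValue_subExit_eq_mul hκ hαβ.1 hαβ.2.1 hθ'
    rw [← hp] at hpeq
    -- `1 - p ≤ (s θ - s y)/d'`
    have hsy : sleScale κ y < sleScale κ θ := hsm hyIcc hθIcc hlt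
    have hden : d' ≤ sleScale κ (θ + η₀) - sleScale κ y := by rw [hd']; linarith
    have h1p : 1 - p ≤ (sleScale κ θ - sleScale κ y) / d' := by
      have heq : (1 - p) * (sleScale κ (θ + η₀) - sleScale κ y) = sleScale κ θ - sleScale κ y := by linarith
      rw [le_div_iff₀ hd'pos]
      calc (1 - p) * d' ≤ (1 - p) * (sleScale κ (θ + η₀) - sleScale κ y) :=
            mul_le_mul_of_nonneg_left hden (by linarith)
        _ = _ := heq
    have hCC : (0 : ℝ) ≤ 2 * C := by positivity
    have hθβ : (θ + η₀ - θ) ^ 2 = η₀ ^ 2 := by ring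
    have hm : 2 / κ * ((θ - y) ^ 2 * p + (θ + η₀ - θ) ^ 2 * (1 - p)) ≤
        2 / κ * ((θ - y) ^ 2 + η₀ ^ 2 * ((sleScale κ θ - sleScale κ y) / d')) := by
      rw [hθβ]
      exact mul_le_mul_of_nonneg_left (add_le_add (mul_le_of_le_one_right (sq_nonneg _) hp1)
        (mul_le_mul_of_nonneg_left h1p (sq_nonneg _))) (by positivity)
    have hmδ := div_le_div_of_nonneg_right hm hδ0.le
    have h2C : 2 * C * (1 - p) ≤ 2 * C * ((sleScale κ θ - sleScale κ y) / d') := mul_le_mul_of_nonneg_left h1p hCC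
    have h3 : 2 * C * (PK + 2 / κ * ((θ - y) ^ 2 * p + (θ + η₀ - θ) ^ 2 * (1 - p)) / δ) ≤
        2 * C * (PK + 2 / κ * ((θ - y) ^ 2 + η₀ ^ 2 * ((sleScale κ θ - sleScale κ y) / d')) / δ) :=
      mul_le_mul_of_nonneg_left (add_le_add le_rfl hmδ) hCC
    have hdist : dist (a y) (a θ) ≤ H y := by
      rw [Real.dist_eq]
      refine hL.trans ?_
      simp only [hH]
      linarith
    exact lt_of_le_of_lt hdist (hHy hyIcc)
  · subst heq; simpa using hε
  · -- right of `θ`: interval `(θ - η₀, y)`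
    have hαβ := hint (α := θ - η₀) (β := y) le_rfl (by linarith [(abs_lt.1 hyθ).2])
    have hθ' : θ ∈ Ioo (θ - η₀) y := ⟨by linarith, hgt⟩
    obtain ⟨hR, -⟩ := abs_sub_le_of_meanValue hκ hαβ.1 hαβ.2.1 hθ' hαβ.2.2 hab hS hφc hφb
      (fun hρ hρσ ↦ hMV N hθn hρ hρσ) (K := K) hδ0 hδ1 hδδ' (by positivity) hunif'
    set p := preWienerMeasure.real {ω | stoppedValue (sleArgLevel κ N θ)
      (Process.exitTime (sleArgLevel κ N θ) (θ - η₀) y) ω = θ - η₀} with hp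
    have hp0 : 0 ≤ p := measureReal_nonneg
    have hp1 : p ≤ 1 := measureReal_le_one
    have hpeq := measureReal_stoppedValue_subExit_eq_mul hκ hαβ.1 hαβ.2.1 hθ'
    rw [← hp] at hpeq
    -- `p ≤ (s y - s θ)/d`
    have hsy : sleScale κ θ < sleScale κ y := hsm hθIcc hyIcc hgt
    have hden : d ≤ sleScale κ y - sleScale κ (θ - η₀) := by rw [hd]; linarith
    have hple : p ≤ (sleScale κ y - sleScale κ θ) / d := by
      rw [le_div_iff₀ hdpos]
      calc p * d ≤ p * (sleScale κ y - sleScale κ (θ - η₀)) := mul_le_mul_of_nonneg_left hden hp0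
        _ = _ := hpeq
    have hCC : (0 : ℝ) ≤ 2 * C := by positivity
    have hθα : (θ - (θ - η₀)) ^ 2 = η₀ ^ 2 := by ring
    have hm : 2 / κ * ((θ - (θ - η₀)) ^ 2 * p + (y - θ) ^ 2 * (1 - p)) ≤
        2 / κ * (η₀ ^ 2 * ((sleScale κ y - sleScale κ θ) / d) + (y - θ) ^ 2) := by
      rw [hθα]
      exact mul_le_mul_of_nonneg_left (add_le_add (mul_le_mul_of_nonneg_left hple (sq_nonneg _))
        (mul_le_of_le_one_right (sq_nonneg _) (by linarith))) (by positivity)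
    have hmδ := div_le_div_of_nonneg_right hm hδ0.le
    have h2C : 2 * C * p ≤ 2 * C * ((sleScale κ y - sleScale κ θ) / d) := mul_le_mul_of_nonneg_left hple hCC
    have h3 : 2 * C * (PK + 2 / κ * ((θ - (θ - η₀)) ^ 2 * p + (y - θ) ^ 2 * (1 - p)) / δ) ≤
        2 * C * (PK + 2 / κ * (η₀ ^ 2 * ((sleScale κ y - sleScale κ θ) / d) + (y - θ) ^ 2) / δ) :=
      mul_le_mul_of_nonneg_left (add_le_add le_rfl hmδ) hCC
    have hdist : dist (a y) (a θ) ≤ G y := by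
      rw [Real.dist_eq]
      refine hR.trans ?_
      simp only [hG]
      linarith
    exact lt_of_le_of_lt hdist (hGy hyIcc)

/-- **Continuity of `a_φ(y) = E^y[φ(T); Y_T = 2π]` on `(0, 2π)`** for a bounded continuous `φ`
(`κ > 4`). [folklore] -/
theorem continuousOn_topExpect {φ : ℝ → ℝ} (hφc : Continuous φ) {C : ℝ} (hφb : ∀ t, |φ t| ≤ C) :
    ContinuousOn (topExpect κ φ) (Ioo 0 (2 * Real.pi)) := fun θ hθ ↦
  (continuousAt_of_meanValue hκ hθ (abs_topExpect_le κ hφb) (measurableSet_sleExitsTop κ θ) hφc hφb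
    (fun _ hθn _ hρ hρσ ↦ integral_topExpect_stoppedValue_eq hκ hθn hρ hρσ hφc.measurable hφb)).continuousWithinAt

/-- **Continuity of `b_φ(y) = E^y[φ(T); Y_T = 0]` on `(0, 2π)`** for a bounded continuous `φ`
(`κ > 4`). [folklore] -/
theorem continuousOn_botExpect {φ : ℝ → ℝ} (hφc : Continuous φ) {C : ℝ} (hφb : ∀ t, |φ t| ≤ C) :
    ContinuousOn (botExpect κ φ) (Ioo 0 (2 * Real.pi)) := fun θ hθ ↦
  (continuousAt_of_meanValue hκ hθ (abs_botExpect_le κ hφb) (measurableSet_sleExitsBot κ θ) hφc hφb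
    (fun _ hθn _ hρ hρσ ↦ integral_botExpect_stoppedValue_eq hκ hθn hρ hρσ hφc.measurable hφb)).continuousWithinAt

end Continuity



end RadialLoewner

end Literature.Probability.RandomPlanarGeometry
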